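import Summits.CriticalPhenomena.PercolationContinuityZ3.Theses.PercNonProliferation
import Literature.Probability.Percolation.KozmaNitzanTargetLemma
import Literature.Probability.Percolation.BondPercolationSymmetry
import HarnessLib

/-!
# Crux `PercNonProliferation.NonProliferation` (stmt-CriticalPhenomena-4444),
# line `boundary-pinning` — stub `stub_multiCrossAt_shift`

Helper file for the lead's skeleton of line `boundary-pinning` (payload slug `Sketch`,
prover-line-stmt-CriticalPhenomena-4444-c1, bulk sibling). Proves exactly the registered stub
signature `stub_multiCrossAt_shift`; lands with `--supports stmt-CriticalPhenomena-4444`.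

The statement: TRANSLATION INVARIANCE of the multi-crosser event. For every `d, M, m, L`,
`p ∈ [0,1]` and `z ∈ ℤ^d`, the event "there are `M + 1` points of `z + B(m)`, each joined
inside `z + B(L)` to the inner vertex boundary of `z + B(L)`, pairwise NOT joined inside
`z + B(L)`" has the same `P_p`-probability as the same event at `z = 0` (stated with `box d m`,
`box d L`).

Proof (the model is `KozmaNitzan.real_uniqZoneAt_eq`). Under the relabelling of configurations
by the translation `Site.shift z` (`s(x, y) ↦ s(x + z, y + z)`), open connection inside
`z + B(L)` between `a + z` and `b + z` of the shifted configuration is open connection inside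
`B(L)` between `a` and `b` of the original one (`GM.relabel_mem_openConnIn_iff`,
`KozmaNitzan.shift_preimage_ball`); the inner boundary of `z + B(L)` is the translate of that
of `B(L)` (`KozmaNitzan.mem_innerBoundary_ball_iff`) and `z + B(m)` is the translate of `B(m)`
(`KozmaNitzan.mem_ball_iff_sub`). Hence the preimage of the event at `z` under the
relabelling is the event at `0` (transport the tuple `x` by `x i ∓ z` and the boundary
witnesses by `y ∓ z`), and the relabelling preserves `P_p`
(`bondPercolation_real_preimage_shift`).
-/

noncomputable section

namespace Summit.CriticalPhenomena.PercolationContinuityZ3.Theorems.NonProliferation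

open MeasureTheory Filter Topology
open Literature.Probability.LatticeModels Literature.Probability.Percolation

namespace StubMultiCrossAtShift

/-- **Shifted open connections inside the shifted box.** For the configuration relabelled by
the translation `Site.shift z`: `a + z ↔ b + z` inside `z + B(L)` iff `a ↔ b` inside `B(L)`
for the original configuration (`GM.relabel_mem_openConnIn_iff` and
`KozmaNitzan.shift_preimage_ball`). -/
theorem relabel_shift_mem_openConnIn_ball_iff {d : ℕ} (z : Site d) (L : ℕ)
    (ω : BondConfig (Site d)) (a b : Site d) :
    BondConfig.relabel (sym2Equiv (Site.shift z)) ω ∈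
        openConnIn (↑(GM.ball z L) : Set (Site d)) (a + z) (b + z) ↔
      ω ∈ openConnIn (↑(box d L) : Set (Site d)) a b := by
  have h := GM.relabel_mem_openConnIn_iff (Site.shift z) (↑(GM.ball z L) : Set (Site d)) a b ω
  rw [Site.shift_apply, Site.shift_apply, KozmaNitzan.shift_preimage_ball] at h
  exact h

/-- **Shifted connections to the shifted boundary.** For the configuration relabelled by the
translation `Site.shift z`: `a + z` is joined inside `z + B(L)` to a point of `∂ⁱⁿ(z + B(L))`
iff `a` is joined inside `B(L)` to a point of `∂ⁱⁿB(L)` for the original configuration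
(boundary witnesses transported by `y ∓ z`, `KozmaNitzan.mem_innerBoundary_ball_iff`). -/
theorem relabel_shift_toBdry_iff {d : ℕ} (z : Site d) (L : ℕ)
    (ω : BondConfig (Site d)) (a : Site d) :
    (∃ y ∈ innerBoundary (zdGraph d) (GM.ball z L),
        BondConfig.relabel (sym2Equiv (Site.shift z)) ω ∈
          openConnIn (↑(GM.ball z L) : Set (Site d)) (a + z) y) ↔
      ∃ y ∈ innerBoundary (zdGraph d) (box d L), ω ∈ openConnIn (↑(box d L) : Set (Site d)) a y := by
  constructor
  · rintro ⟨w, hw, h⟩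
    refine ⟨w - z, KozmaNitzan.mem_innerBoundary_ball_iff.1 hw, ?_⟩
    rw [← relabel_shift_mem_openConnIn_ball_iff z L ω a (w - z), sub_add_cancel]
    exact h
  · rintro ⟨w, hw, h⟩
    refine ⟨w + z, ?_, (relabel_shift_mem_openConnIn_ball_iff z L ω a w).2 h⟩
    rw [KozmaNitzan.mem_innerBoundary_ball_iff, add_sub_cancel_right]
    exact hw

/-- **The preimage of the multi-crosser event at `z` under the shift relabelling is the
multi-crosser event at the origin** (transport the tuple of points by `x i ∓ z`; membership in
`z + B(m)` is `KozmaNitzan.mem_ball_iff_sub`). -/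
theorem relabel_shift_preimage_multiCross {d : ℕ} (M m L : ℕ) (z : Site d) :
    BondConfig.relabel (sym2Equiv (Site.shift z)) ⁻¹'
      {ω | ∃ x : Fin (M + 1) → Site d, (∀ i, x i ∈ GM.ball z m) ∧
        (∀ i, ∃ y ∈ innerBoundary (zdGraph d) (GM.ball z L),
          ω ∈ openConnIn (↑(GM.ball z L) : Set (Site d)) (x i) y) ∧
        ∀ i j, i ≠ j → ω ∉ openConnIn (↑(GM.ball z L) : Set (Site d)) (x i) (x j)} =
      {ω | ∃ x : Fin (M + 1) → Site d, (∀ i, x i ∈ box d m) ∧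
        (∀ i, ∃ y ∈ innerBoundary (zdGraph d) (box d L),
          ω ∈ openConnIn (↑(box d L) : Set (Site d)) (x i) y) ∧
        ∀ i j, i ≠ j → ω ∉ openConnIn (↑(box d L) : Set (Site d)) (x i) (x j)} := by
  ext ω
  simp only [Set.mem_preimage, Set.mem_setOf_eq]
  constructor
  · rintro ⟨x, hxm, hxB, hxD⟩
    refine ⟨fun i => x i - z, fun i => KozmaNitzan.mem_ball_iff_sub.1 (hxm i), fun i => ?_,
      fun i j hij h => hxD i j hij ?_⟩
    · rw [← relabel_shift_toBdry_iff z L ω (x i - z), sub_add_cancel]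
      exact hxB i
    · rw [← relabel_shift_mem_openConnIn_ball_iff z L ω (x i - z) (x j - z), sub_add_cancel,
        sub_add_cancel] at h
      exact h
  · rintro ⟨x, hxm, hxB, hxD⟩
    refine ⟨fun i => x i + z, fun i => ?_, fun i => (relabel_shift_toBdry_iff z L ω (x i)).2 (hxB i),
      fun i j hij h => hxD i j hij ((relabel_shift_mem_openConnIn_ball_iff z L ω (x i) (x j)).1 h)⟩
    rw [KozmaNitzan.mem_ball_iff_sub, add_sub_cancel_right]
    exact hxm i

end StubMultiCrossAtShift

/-- **Stub `stub_multiCrossAt_shift`** of line `boundary-pinning` (crux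
stmt-CriticalPhenomena-4444, bulk sibling): translation invariance of the multi-crosser event —
`M + 1` points of `z + B(m)`, each joined inside `z + B(L)` to `∂ⁱⁿ(z + B(L))`, pairwise not
joined inside `z + B(L)` — its `P_p`-probability equals that of the same event at the origin.
The preimage of the event at `z` under the shift relabelling is the event at `0`
(`StubMultiCrossAtShift.relabel_shift_preimage_multiCross`) and the relabelling preserves `P_p`
(`bondPercolation_real_preimage_shift`). -/
theorem stub_multiCrossAt_shift :
    ∀ (d M m L : ℕ) (p : unitInterval) (z : Site d),
    (bondPercolation (zdGraph d) p).real
      {ω | ∃ x : Fin (M + 1) → Site d, (∀ i, x i ∈ GM.ball z m) ∧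
        (∀ i, ∃ y ∈ innerBoundary (zdGraph d) (GM.ball z L),
          ω ∈ openConnIn (↑(GM.ball z L) : Set (Site d)) (x i) y) ∧
        ∀ i j, i ≠ j → ω ∉ openConnIn (↑(GM.ball z L) : Set (Site d)) (x i) (x j)} =
    (bondPercolation (zdGraph d) p).real
      {ω | ∃ x : Fin (M + 1) → Site d, (∀ i, x i ∈ box d m) ∧
        (∀ i, ∃ y ∈ innerBoundary (zdGraph d) (box d L),
          ω ∈ openConnIn (↑(box d L) : Set (Site d)) (x i) y) ∧
        ∀ i j, i ≠ j → ω ∉ openConnIn (↑(box d L) : Set (Site d)) (x i) (x j)} := by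
  intro d M m L p z
  rw [← StubMultiCrossAtShift.relabel_shift_preimage_multiCross M m L z,
    bondPercolation_real_preimage_shift]

end Summit.CriticalPhenomena.PercolationContinuityZ3.Theorems.NonProliferation

end
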